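import Summits.QuantumFields.YangMills.Theorems.SourcedPressureJensenColdBoxSourcedPressureCellSourceZd
import Mathlib.Probability.Moments.Variance
import HarnessLib

/-!
# `ColdBoxSourcedPressure` (KS1″, stmt-QuantumFields-24297), line «birth»: the TILTED SUSCEPTIBILITY as a free-cube quantity

Lead `ym-line-spj-p1` (g3).  The second registered stub of the line bounds the variance of the route's pair source `X = cellSource` under the
SOURCED free-cell state `ν.tilted (−u·X)` (`ν = freeCellState r β ℓ L`, realised inside an ambient torus of side `L+1`).  Here that variance is
identified with a pure Chatterjee free-cube quantity, independent of the ambient torus: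

* `freeCellTiltedMoment r β m ℓ n u k = zdExpect r.ρ β B_{ℓ+1} (X_ℤ^k · e^{−u X_ℤ})` (`X_ℤ = cellSourceZd`, `B_{ℓ+1} = halfOpenBox 4 (ℓ+1)`);
* `freeCellTiltedVar r β m ℓ n u = M₂/M₀ − (M₁/M₀)²`, the variance of `X_ℤ` under the `u`-sourced free-cube measure;
* `integral_pow_mul_exp_cellSource_freeCellState` — `∫ X^k e^{−uX} dν = freeCellTiltedMoment … u k` (`ℓ + 1 ≤ L`); `freeCellTiltedMoment_zero_pos`;
* **`variance_tilted_cellSource_eq`** — `Var[X; ν.tilted (−u·X)] = freeCellTiltedVar r β m ℓ n u` (`ℓ + 1 ≤ L`).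

So `stub_tiltedVariance` is equivalently the free-cube statement `freeCellTiltedVar r β m ℓ n u ≤ M·(ℓ+1)⁴` (uniformly in `0 < u ≤ h₀(W)`,
`|m| ≤ W`, cells `ℓ+1 ∈ [β^θ, 4β^θ]`, `1 ≤ n ≤ 2β^A`) — no torus, no `L`.
HONEST LABEL: RECORD-label rung support (route target `WeakCouplingRates.XiPow`, an UPPER bound on the lattice gap, meanwhile proved in tree by
another line); the Yang–Mills mass gap is NOT proved by anything here.
-/

set_option autoImplicit false

noncomputable section

open MeasureTheory ProbabilityTheory Finset
open Literature.Probability.LatticeModels Literature.MathematicalPhysics.QuantumLattice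
open Literature.MathematicalPhysics.QuantumFieldTheory Literature.MathematicalPhysics.QuantumFieldTheory.AreaLaw
open Summit.QuantumFields.YangMills.Theorems.WeakCouplingRates
open Summit.QuantumFields.YangMills.Theorems.SourcedPressureJensen

namespace Summit.QuantumFields.YangMills.Cruxes.ColdBoxSourcedPressure.Birth

variable {G : Type} [Group G] [TopologicalSpace G] [IsTopologicalGroup G] [CompactSpace G]
  [MeasurableSpace G] [BorelSpace G]

/-! ### The sourced free-cube moments and variance -/

/-- The `k`-th SOURCED free-cube moment `zdExpect r.ρ β B_{ℓ+1} (X_ℤ^k · e^{−u·X_ℤ})` of the pair source `X_ℤ = cellSourceZd r β m ℓ n`. -/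
def freeCellTiltedMoment (r : LatticeRep G) (β m : ℝ) (ℓ n : ℕ) (u : ℝ) (k : ℕ) : ℝ :=
  zdExpect r.ρ β (halfOpenBox 4 (ℓ + 1)) (fun V => cellSourceZd r β m ℓ n V ^ k * Real.exp (-u * cellSourceZd r β m ℓ n V))

/-- The variance of the pair source under the `u`-SOURCED free-cube measure `e^{−u X_ℤ} dμ_{B_{ℓ+1},β} / (normalisation)`:
`M₂/M₀ − (M₁/M₀)²` with `M_k = freeCellTiltedMoment … u k`. -/
def freeCellTiltedVar (r : LatticeRep G) (β m : ℝ) (ℓ n : ℕ) (u : ℝ) : ℝ :=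
  freeCellTiltedMoment r β m ℓ n u 2 / freeCellTiltedMoment r β m ℓ n u 0 -
    (freeCellTiltedMoment r β m ℓ n u 1 / freeCellTiltedMoment r β m ℓ n u 0) ^ 2

/-! ### Bridge: torus-side sourced moments are free-cube moments -/

/-- `∫ X^k e^{−uX} dν = freeCellTiltedMoment r β m ℓ n u k` for the route's torus-encoded source `X = cellSource r β m ℓ n L` and free-cell state
`ν = freeCellState r β ℓ L`, `ℓ + 1 ≤ L` (independent of `L`). -/
theorem integral_pow_mul_exp_cellSource_freeCellState (r : LatticeRep G) (β m : ℝ) {ℓ L : ℕ} (hL : ℓ + 1 ≤ L) (n : ℕ) (u : ℝ)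
    (k : ℕ) :
    ∫ U, cellSource r β m ℓ n L U ^ k * Real.exp (-u * cellSource r β m ℓ n L U) ∂(freeCellState r β ℓ L) =
      freeCellTiltedMoment r β m ℓ n u k := by
  haveI := r.secondCountableTopology
  simp_rw [cellSource_eq_cellSourceZd_torusLift r β m hL n]
  exact integral_comp_torusLift_freeCellState r β hL
    (F := fun V => cellSourceZd r β m ℓ n V ^ k * Real.exp (-u * cellSourceZd r β m ℓ n V))
    (((continuous_cellSourceZd r β m ℓ n).measurable.pow_const k).mul
      (Real.measurable_exp.comp ((continuous_cellSourceZd r β m ℓ n).measurable.const_mul _)))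
    (dependsOn_comp (dependsOn_cellSourceZd r β m ℓ n) fun s => s ^ k * Real.exp (-u * s))

/-- All exponential moments of the (bounded, continuous) source exist under the free-cell state. -/
theorem integrable_exp_mul_cellSource_freeCellState (r : LatticeRep G) (β m : ℝ) (ℓ n L : ℕ) (t : ℝ) :
    Integrable (fun U => Real.exp (t * cellSource r β m ℓ n L U)) (freeCellState r β ℓ L) := by
  haveI := isProbabilityMeasure_freeCellState r β ℓ L
  haveI := r.secondCountableTopology
  exact (Real.continuous_exp.comp (continuous_const.mul (continuous_cellSource r β m ℓ n L))).integrable_of_hasCompactSupport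
    (HasCompactSupport.of_compactSpace _)

/-- The sourced normalisation `M₀ = ∫ e^{−uX} dν` is positive. -/
theorem freeCellTiltedMoment_zero_pos (r : LatticeRep G) (β m : ℝ) {ℓ L : ℕ} (hL : ℓ + 1 ≤ L) (n : ℕ) (u : ℝ) :
    0 < freeCellTiltedMoment r β m ℓ n u 0 := by
  haveI := isProbabilityMeasure_freeCellState r β ℓ L
  rw [← integral_pow_mul_exp_cellSource_freeCellState r β m hL n u 0]
  simp only [pow_zero, one_mul]
  exact integral_exp_pos (integrable_exp_mul_cellSource_freeCellState r β m ℓ n L (-u))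

/-- **The tilted susceptibility is a free-cube quantity**: for `ℓ + 1 ≤ L` and every `u`,
`Var[cellSource; (freeCellState).tilted (−u·cellSource)] = freeCellTiltedVar r β m ℓ n u`. -/
theorem variance_tilted_cellSource_eq (r : LatticeRep G) (β m : ℝ) {ℓ L : ℕ} (hL : ℓ + 1 ≤ L) (n : ℕ) (u : ℝ) :
    Var[cellSource r β m ℓ n L; (freeCellState r β ℓ L).tilted (fun U => -u * cellSource r β m ℓ n L U)] =
      freeCellTiltedVar r β m ℓ n u := by
  haveI := isProbabilityMeasure_freeCellState r β ℓ L
  haveI := r.secondCountableTopology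
  set ν := freeCellState r β ℓ L with hν
  set X := cellSource r β m ℓ n L with hX
  have hXc : Continuous X := continuous_cellSource r β m ℓ n L
  have hexp : Integrable (fun U => Real.exp (-u * X U)) ν :=
    integrable_exp_mul_cellSource_freeCellState r β m ℓ n L (-u)
  haveI : IsProbabilityMeasure (ν.tilted fun U => -u * X U) := isProbabilityMeasure_tilted hexp
  -- `X` is bounded, hence in `L²` of the tilted state
  obtain ⟨K, hK⟩ := exists_abs_le_of_continuous (L := L + 1) hXc
  have hmem : MemLp X 2 (ν.tilted fun U => -u * X U) :=
    MemLp.of_bound hXc.aestronglyMeasurable K (ae_of_all _ fun U => by rw [Real.norm_eq_abs]; exact hK U)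
  rw [variance_eq_sub hmem]
  -- the two tilted moments as ratios of `ν`-integrals
  have hM0 : ∫ U, Real.exp (-u * X U) ∂ν = freeCellTiltedMoment r β m ℓ n u 0 := by
    rw [← integral_pow_mul_exp_cellSource_freeCellState r β m hL n u 0]
    simp only [pow_zero, one_mul, hX, hν]
  have hM : ∀ k : ℕ, ∫ U, (X ^ k) U ∂(ν.tilted fun U => -u * X U) =
      freeCellTiltedMoment r β m ℓ n u k / freeCellTiltedMoment r β m ℓ n u 0 := by
    intro k
    rw [integral_tilted]
    simp only [Pi.pow_apply, smul_eq_mul]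
    have e : ∀ U, Real.exp (-u * X U) / (∫ U, Real.exp (-u * X U) ∂ν) * X U ^ k =
        (∫ U, Real.exp (-u * X U) ∂ν)⁻¹ * (X U ^ k * Real.exp (-u * X U)) := fun U => by ring
    simp_rw [e]
    rw [integral_const_mul, hM0, ← integral_pow_mul_exp_cellSource_freeCellState r β m hL n u k]
    simp only [hX, hν]
    ring
  have h1 : ∫ U, X U ∂(ν.tilted fun U => -u * X U) = freeCellTiltedMoment r β m ℓ n u 1 / freeCellTiltedMoment r β m ℓ n u 0 := by
    simpa only [pow_one] using hM 1
  rw [hM 2, h1]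
  rfl

end Summit.QuantumFields.YangMills.Cruxes.ColdBoxSourcedPressure.Birth

end
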